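import Summits.QuantumFields.QCD.Theses.PauliWegnerSea
import Literature.MathematicalPhysics.QuantumFieldTheory.QCDPhaseQuenched

/-!
# `GluonicCompletion` (crux stmt-QuantumFields-9152) — negative-side support: the flanks hide no
# counterexample (flavour range, dropped hypotheses)

Definition-free extract of the standing disprover's `Disproof.lean` (cdisprove g2, §2–§3):
* `scaling_canonicalAF`: the scaling side conditions of the crux's hypothesis (leading-log `HasMassScaling`
  and two-loop `HasAsymptoticScaling` of `reg.scheme 0 0 0`) are inhabited by the tree's `canonicalAF`.
* `withoutPerMass_iff_QCD`: dropping the whole per-mass package from the hypothesis turns the crux into the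
  summit conjunct `QCD` itself — the per-mass clauses are the only thing separating this item from `QCD`
  (and every weakening of the hypothesis stays implied by `QCD`, so no "false without H" theorem exists
  short of `¬QCD`).
* `hypothesisPackage_zero`: at `N_f = 0` the ENTIRE hypothesis package of the crux holds (clauses (i)–(iii)
  and the flavour-charged decay quantify over `Fin 0`; (iv) holds with ratio `1`: the empty Dirac matrix has
  determinant `1` and `μ_W` is a probability measure) — so extending the crux below `N_f = 2` yields
  `QCDOf 0`, an open pure-`SU(3)` statement (`qcdOf_zero_iff_chiral`: the mass quantifier collapses, the
  non-decoupling clause is vacuous, and — since the 2026-08-16 re-type of `QCDOf` — the chiral-point clause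
  `IsChiralAtZero` collapses to gaplessness of the zero-shift scheme `reg.scheme ![] 0 0`), not a
  counterexample; `nondecoupling_vacuous_one` records the `N_f = 1` flank.

Maintenance note (full-build repair 2026-08-17): `QCDOf` gained the conjunct `reg.IsChiralAtZero`; the old
unfolding `qcdOf_zero_iff` (without it) stopped elaborating and survives as the deprecated alias of
`qcdOf_zero_iff_chiral`. No other statement changed.
-/

noncomputable section

namespace Summit.QuantumFields.QCD.Theorems.GluonicCompletion.Negative

open MeasureTheory Filter
open Literature.MathematicalPhysics.QuantumFieldTheory Literature.MathematicalPhysics.QuantumLattice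
  Literature.Probability.LatticeModels

/-- The scaling side conditions of the hypothesis are inhabited by `canonicalAF` (`a_k = 1/(k+1)`,
`β_k = afBeta N_f 1 a_k`, `Z_m(k) = (log a_k⁻²)^{γ₀/(2β₀)}`, `m_crit ≡ 0`). [folklore] -/
theorem scaling_canonicalAF (Nf : ℕ) :
    (QCDRegularisation.canonicalAF Nf).HasMassScaling ∧
      ((QCDRegularisation.canonicalAF Nf).scheme 0 0 0).HasAsymptoticScaling := by
  refine ⟨QCDRegularisation.canonicalAF_hasMassScaling, 1, one_pos, ?_⟩
  refine tendsto_const_nhds.congr' (Eventually.of_forall fun k => ?_)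
  simp [QCDRegularisation.scheme, QCDRegularisation.canonicalAF, QCDScheme.zeroAF]

/-- **Dropping the per-mass package turns the crux into `QCD`.** [folklore] -/
theorem withoutPerMass_iff_QCD :
    (∀ Nf : ℕ, Nf = 2 ∨ Nf = 3 →
      (∃ reg : QCDRegularisation Nf, reg.HasMassScaling ∧ (reg.scheme 0 0 0).HasAsymptoticScaling) → QCDOf Nf) ↔
      _root_.QCD := by
  refine ⟨fun h => ⟨h 2 (Or.inl rfl) ⟨_, scaling_canonicalAF 2⟩, h 3 (Or.inr rfl) ⟨_, scaling_canonicalAF 3⟩⟩, ?_⟩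
  rintro ⟨h2, h3⟩ Nf (rfl | rfl) _
  exacts [h2, h3]

/-- **At `N_f = 0` the entire hypothesis package of the crux holds** (witness `canonicalAF 0`). [folklore] -/
theorem hypothesisPackage_zero :
    open MeasureTheory Filter Literature.MathematicalPhysics.QuantumFieldTheory Literature.MathematicalPhysics.QuantumLattice Literature.Probability.LatticeModels in
    ∃ reg : QCDRegularisation 0, reg.HasMassScaling ∧ (reg.scheme 0 0 0).HasAsymptoticScaling ∧ ∀ m : Fin 0 → ℝ, (∀ f, 0 < m f) → ((∀ f : Fin 0, ∀ᶠ k in atTop, -1 < reg.mcrit k + reg.a k * m f / reg.Zm k) ∧ (∃ s δ C : ℝ, 0 < s ∧ s < 1 ∧ 0 < δ ∧ ∀ᶠ k in atTop, ∀ S : ℕ, reg.L k ≤ S → ∀ (f : Fin 0) (v : Literature.Probability.LatticeModels.Site 4), v ∈ box 4 S → (∫ U : GaugeConfig 4 (2 * S + 1) (Matrix.specialUnitaryGroup (Fin 3) ℂ), ‖(diracMatrix U fun fl => reg.mcrit k + reg.a k * m fl / reg.Zm k).det‖ * (∑ a : Fin 3, ∑ i : Fin 4, ∑ b : Fin 3,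 ∑ j : Fin 4, ‖(diracMatrix U fun fl => reg.mcrit k + reg.a k * m fl / reg.Zm k)⁻¹ (quarkEquiv (f, (Torus.proj (2 * S + 1) 0, a, i))) (quarkEquiv (f, (Torus.proj (2 * S + 1) (v), b, j)))‖) ^ s ∂(wilsonMeasure (fundamentalRep (Fin 3)) (reg.β k))) / (∫ U : GaugeConfig 4 (2 * S + 1) (Matrix.specialUnitaryGroup (Fin 3) ℂ), ‖(diracMatrix U fun fl => reg.mcrit k + reg.a k * m fl / reg.Zm k).det‖ ∂(wilsonMeasure (fundamentalRep (Fin 3)) (reg.β k))) ≤ C * Real.exp (-(δ * (reg.a k * ‖v‖)))) ∧ (∃ s c₀ C₁ p : ℝ, 0 < s ∧ s < 1 ∧ 0 < c₀ ∧ ∀ᶠ k in atTop, ∀ S : ℕ, reg.L k ≤ S → ∀ (f : Fin 0) (n : ℕ), n ≤ S → c₀ * Real.exp (-(C₁ * (reg.a k * n) + p * Real.log (n + 1))) ≤ (∫ U : GaugeConfig 4 (2 * S + 1) (Matrix.specialUnitaryGroup (Fin 3) ℂ), ‖(diracMatrix U fun fl => reg.mcrit k + reg.a k * m fl / reg.Zm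 k).det‖ * (∑ a : Fin 3, ∑ i : Fin 4, ∑ b : Fin 3, ∑ j : Fin 4, ‖(diracMatrix U fun fl => reg.mcrit k + reg.a k * m fl / reg.Zm k)⁻¹ (quarkEquiv (f, (Torus.proj (2 * S + 1) 0, a, i))) (quarkEquiv (f, (Torus.proj (2 * S + 1) (Pi.single 0 (n : ℤ)), b, j)))‖) ^ s ∂(wilsonMeasure (fundamentalRep (Fin 3)) (reg.β k))) / (∫ U : GaugeConfig 4 (2 * S + 1) (Matrix.specialUnitaryGroup (Fin 3) ℂ), ‖(diracMatrix U fun fl => reg.mcrit k + reg.a k * m fl / reg.Zm k).det‖ ∂(wilsonMeasure (fundamentalRep (Fin 3)) (reg.β k)))) ∧ (∀ᶠ k in atTop, (1 / 2 : ℝ) ≤ ‖∫ U : GaugeConfig 4 (2 * reg.L k + 1) (Matrix.specialUnitaryGroup (Fin 3) ℂ), (diracMatrix U fun fl => reg.mcrit k + reg.a k * m fl / reg.Zm k).det ∂(wilsonMeasure (fundamentalRep (Fin 3)) (reg.β k))‖ / (∫ U : GaugeConfig 4 (2 * reg.L k + 1) (Matrix.specialUnitaryGroup (Fin 3) ℂ),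 ‖(diracMatrix U fun fl => reg.mcrit k + reg.a k * m fl / reg.Zm k).det‖ ∂(wilsonMeasure (fundamentalRep (Fin 3)) (reg.β k))))) ∧ (∃ δ' : ℝ, 0 < δ' ∧ ∀ (R R' : ℕ) (A : QCDLatticeObservable 0 R) (B : QCDLatticeObservable 0 R'), (∃ (f₀ : Fin 0) (q : ℤ), q ≠ 0 ∧ ∀ (θ : ℝ) (U : LGConfig 4 (Matrix.specialUnitaryGroup (Fin 3) ℂ)), ExteriorAlgebra.map (LinearMap.pi fun w => (Sum.elim (fun i => if (boxQuarkEquiv.symm i).1 = f₀ then Complex.exp (-((θ : ℂ) * Complex.I)) else 1) (fun i => if (boxQuarkEquiv.symm i).1 = f₀ then Complex.exp ((θ : ℂ) * Complex.I) else 1) (ofLex w)) • LinearMap.proj w) (A.F U) = Complex.exp (((q : ℝ) * θ : ℝ) * Complex.I) • A.F U) → ∃ C' : ℝ, ∀ᶠ k in atTop, ∀ S : ℕ, reg.L k ≤ S → ∀ n : ℕ, n ≤ S → ‖(∫ U : GaugeConfig 4 (2 * S + 1) (Matrix.specialUnitaryGroup (Fin 3) ℂ), (‖(diracMatrix U fun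 fl => reg.mcrit k + reg.a k * m fl / reg.Zm k).det‖ : ℂ) * (fermiIntegral (A.onTorus (2 * S + 1) 0 U * B.onTorus (2 * S + 1) (Pi.single 0 (n : ℤ)) U * fermiBoltzmann U fun fl => reg.mcrit k + reg.a k * m fl / reg.Zm k) / fermiIntegral (fermiBoltzmann U fun fl => reg.mcrit k + reg.a k * m fl / reg.Zm k)) ∂(wilsonMeasure (fundamentalRep (Fin 3)) (reg.β k))) / (∫ U : GaugeConfig 4 (2 * S + 1) (Matrix.specialUnitaryGroup (Fin 3) ℂ), (‖(diracMatrix U fun fl => reg.mcrit k + reg.a k * m fl / reg.Zm k).det‖ : ℂ) ∂(wilsonMeasure (fundamentalRep (Fin 3)) (reg.β k)))‖ ≤ C' * Real.exp (-(δ' * (reg.a k * n)))) := by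
  refine ⟨QCDRegularisation.canonicalAF 0, (scaling_canonicalAF 0).1, (scaling_canonicalAF 0).2, fun m _ => ?_⟩
  refine ⟨⟨fun f => f.elim0, ⟨1 / 2, 1, 0, by norm_num, by norm_num, one_pos,
    Eventually.of_forall fun k S _ f => f.elim0⟩, ⟨1 / 2, 1, 0, 0, by norm_num, by norm_num, one_pos,
    Eventually.of_forall fun k S _ f => f.elim0⟩, Eventually.of_forall fun k => ?_⟩,
    ⟨1, one_pos, fun R R' A B hA => ?_⟩⟩
  · have h1 : ∀ U : GaugeConfig 4 (2 * (QCDRegularisation.canonicalAF 0).L k + 1) SU3,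
        (diracMatrix U fun fl : Fin 0 => (QCDRegularisation.canonicalAF 0).mcrit k +
          (QCDRegularisation.canonicalAF 0).a k * m fl / (QCDRegularisation.canonicalAF 0).Zm k).det = 1 :=
      fun U => by rw [det_diracMatrix]; simp
    simp_rw [h1]
    simp
    norm_num
  · obtain ⟨f₀, -⟩ := hA
    exact f₀.elim0

/-- … so the crux extended to `N_f = 0` reads `QCDOf 0`, whose mass quantifier collapses (`Fin 0 → ℝ` is a
singleton), whose non-decoupling clause is vacuous, and whose chiral-point clause `IsChiralAtZero` (statement
re-type 2026-08-16) collapses to "the zero-shift pure-gauge scheme `reg.scheme ![] 0 0` has lattice gap below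
every `ε > 0`": the pure-`SU(3)` (quenched) OS-data-with-gap statement with that side condition — open, not a
counterexample. [folklore] -/
theorem qcdOf_zero_iff_chiral : QCDOf 0 ↔ ∃ reg : QCDRegularisation 0, reg.HasMassScaling ∧
    (∀ ε > (0 : ℝ), ¬ (reg.scheme ![] 0 0).HasLatticeMassGap ε) ∧
    ∃ (z shift : QCDField 0 → ℕ → ℝ) (T : OSData (QCDField 0) 4),
      IsQCDAlong (reg.scheme ![] z shift) T ∧ T.IsNontrivial QCDField.glue ∧ T.IsNonGaussian QCDField.glue ∧
        ∃ Δ > 0, T.HasMassGap Δ ∧ (reg.scheme ![] z shift).HasLatticeMassGap Δ := by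
  constructor
  · rintro ⟨reg, hMS, hχ, h⟩
    obtain ⟨z, shift, T, hQ, hN, hG, -, hΔ⟩ := h ![] (fun f => f.elim0)
    refine ⟨reg, hMS, fun ε hε hgap => ?_, z, shift, T, hQ, hN, hG, hΔ⟩
    obtain ⟨m, -, hm⟩ := hχ ε hε
    have hm0 : m = ![] := funext fun f => f.elim0
    subst hm0
    exact hm hgap
  · rintro ⟨reg, hMS, hχ, z, shift, T, hQ, hN, hG, hΔ⟩
    refine ⟨reg, hMS, fun ε hε => ⟨![], fun f => f.elim0, hχ ε hε⟩, fun m _ => ?_⟩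
    have hm : m = ![] := funext fun f => f.elim0
    subst hm
    exact ⟨z, shift, T, hQ, hN, hG, fun f => f.elim0, hΔ⟩

/-- Deprecated spelling: the landed `qcdOf_zero_iff` (p69773) unfolded `QCDOf 0` before the 2026-08-16 statement
re-type added the chiral-point clause `IsChiralAtZero` to `QCDOf`; that unfolding is no longer an equivalence, so
the name now points at the re-typed unfolding `qcdOf_zero_iff_chiral` (append-only: deprecate, don't mutate). -/
@[deprecated qcdOf_zero_iff_chiral (since := "2026-08-17")]
alias qcdOf_zero_iff := qcdOf_zero_iff_chiral

/-- `N_f = 1`: the non-decoupling clause of `QCDOf 1` is vacuous (`Fin 1` has no pair `f ≠ g`). [folklore] -/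
theorem nondecoupling_vacuous_one (T : OSData (QCDField 1) 4) :
    ∀ f g : Fin 1, f ≠ g → T.IsNontrivial (QCDField.pseudoRe f g) :=
  fun f g hfg => absurd (Subsingleton.elim f g) hfg

end Summit.QuantumFields.QCD.Theorems.GluonicCompletion.Negative

end
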